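import Mathlib.Topology.IsLocalHomeomorph
import Mathlib.Topology.Maps.Proper.CompactlyGenerated
import Mathlib.Topology.LocallyConstant.Basic
import Mathlib.Topology.Separation.Hausdorff
import Mathlib.Topology.Connected.Clopen
import Mathlib.Data.Set.Card
import HarnessLib

/-!
# Proper local homeomorphisms: finite fibres, locally constant fibre cardinality, bijectivity

Topic `Literature/Topology` (general topology infrastructure).  For a **proper local homeomorphism**
`f : X → Y` (`IsLocalHomeomorph f`, `IsProperMap f`) with `X` Hausdorff:

* every fibre `f ⁻¹' {y}` is finite (`IsLocallyInjective.finite_preimage_singleton`: compact and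
  met by each local-injectivity neighbourhood in one point);
* the fibre cardinality `y ↦ (f ⁻¹' {y}).ncard` is locally constant
  (`IsLocalHomeomorph.isLocallyConstant_ncard_preimage`: separate the finitely many points of the
  fibre by pairwise disjoint open sets on which `f` is injective; off the image of the closed
  complement — a closed set, `f` being proper — every nearby fibre has exactly one point in each
  of these sets);
* hence it is constant along preconnected sets / on a connected `Y`
  (`IsLocalHomeomorph.ncard_preimage_eq_of_isPreconnected`, `…_eq`), `f` is onto when `Y` is
  connected and `X` nonempty (`IsLocalHomeomorph.surjective_of_isProperMap`), and `f` is a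
  bijection — indeed a homeomorphism (`IsLocalHomeomorph.exists_homeomorph_of_bijective`) — as soon as
  ONE fibre in each component is a singleton (`IsLocalHomeomorph.bijective_of_existsUnique`,
  `…_of_forall_existsUnique`);
* in particular a local homeomorphism of a connected, Hausdorff, weakly locally compact space into
  itself which is the identity off a compact set `K` and omits some point of `K ∪ f '' K` from
  `K ∪ f '' K` is a bijection (`IsLocalHomeomorph.bijective_of_forall_notMem`, with
  `isProperMap_of_forall_notMem`).

This is the elementary "counting sheets" argument (a proper local homeomorphism is a finite
covering and the number of sheets is locally constant), arranged so that neither covering-space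
theory nor degree theory nor simple connectivity is used: O. Forster, *Lectures on Riemann
Surfaces*, GTM 81 (1981), §4.21–4.24 (the topological half of "proper holomorphic maps have a
degree"); T. tom Dieck, *Algebraic Topology* (2008), §3.3.  In this topic it is the injectivity
device of the smoothing theory of piecewise-differentiable homeomorphisms (Munkres, Ann. of Math.
72 (1960); Campbell–D'Onofrio–Vítek, J. Geom. Anal. (2026), Lemma 2.4 — there via degree theory).

Mathlib has `IsLocalHomeomorph` (an open map, `IsLocalHomeomorph.isLocallyInjective`),
`IsProperMap` (`isCompact_preimage`, `isClosedMap`) and covering maps with their lifting theory,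
but no statement linking proper local homeomorphisms to fibre cardinality
(`lean search 'IsProperMap.*IsLocalHomeomorph|IsLocalHomeomorph.*IsProperMap'`: no hits).
Everything here is proved; no definitions, no named facts.
-/

open Set Function Filter Topology

namespace Literature.Topology

variable {X Y : Type*} [TopologicalSpace X] [TopologicalSpace Y] {f : X → Y}

/-! ### Finite fibres -/

/-- **The fibres of a locally injective proper map are finite**: the fibre `f ⁻¹' {y}` is compact
(`f` proper) and each of its points `x` has an open neighbourhood `U x` on which `f` is injective,
so `U x` meets the fibre in `x` only; finitely many `U x` cover the fibre, which is therefore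
contained in the finite index set. Forster (1981), §4.21. [folklore] -/
theorem IsLocallyInjective.finite_preimage_singleton (hf : IsLocallyInjective f)
    (hp : IsProperMap f) (y : Y) : (f ⁻¹' {y}).Finite := by
  classical
  have hTc : IsCompact (f ⁻¹' {y}) := hp.isCompact_preimage isCompact_singleton
  choose U hUo hxU hUinj using hf
  obtain ⟨S, hST, hSfin, hTS⟩ := hTc.elim_finite_subcover_image
    (fun x (_ : x ∈ f ⁻¹' {y}) => hUo x) (fun x hx => mem_iUnion₂.2 ⟨x, hx, hxU x⟩)
  refine hSfin.subset fun x hx => ?_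
  obtain ⟨x', hx'S, hxx'⟩ := mem_iUnion₂.1 (hTS hx)
  have hfx : f x = y := hx
  have hfx' : f x' = y := hST hx'S
  have : x = x' := hUinj x' hxx' (hxU x') (hfx.trans hfx'.symm)
  exact this ▸ hx'S

/-- The fibres of a proper local homeomorphism are finite. [folklore] -/
theorem IsLocalHomeomorph.finite_preimage_singleton (hf : IsLocalHomeomorph f)
    (hp : IsProperMap f) (y : Y) : (f ⁻¹' {y}).Finite :=
  IsLocallyInjective.finite_preimage_singleton hf.isLocallyInjective hp y

/-! ### The fibre cardinality is locally constant -/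

/-- **Counting sheets.** For a proper local homeomorphism `f : X → Y` with `X` Hausdorff, the
number of points in the fibre, `y ↦ (f ⁻¹' {y}).ncard`, is a locally constant function on `Y`.
Proof: the fibre `{x₁, …, x_k}` of `y` is finite; choose pairwise disjoint open sets `W i ∋ x_i`
on which `f` is injective (Hausdorff separation of finitely many points, local injectivity); the
complement `C` of `⋃ W i` is closed, so `f '' C` is closed (`f` proper) and misses `y`; the sets
`f '' (W i)` are open (`f` open).  On the neighbourhood `N = ⋂ f '' (W i) ∖ f '' C` of `y`
every fibre lies in `⋃ W i` and has exactly one point in each `W i`, so has `k` points.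
Forster (1981), §4.22; tom Dieck (2008), §3.3. [folklore] -/
theorem IsLocalHomeomorph.isLocallyConstant_ncard_preimage [T2Space X]
    (hf : IsLocalHomeomorph f) (hp : IsProperMap f) :
    IsLocallyConstant fun y => (f ⁻¹' {y}).ncard := by
  classical
  refine (IsLocallyConstant.iff_eventually_eq _).2 fun y => ?_
  have hfin : (f ⁻¹' {y}).Finite := IsLocalHomeomorph.finite_preimage_singleton hf hp y
  -- separate the points of the fibre by open sets, and shrink to local-injectivity sets
  obtain ⟨U, hU, hdisj⟩ := hfin.t2_separation
  choose V hVo hxV hVinj using hf.isLocallyInjective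
  set W : X → Set X := fun x => U x ∩ V x with hW
  have hWo : ∀ x, IsOpen (W x) := fun x => (hU x).2.inter (hVo x)
  have hxW : ∀ x, x ∈ W x := fun x => ⟨(hU x).1, hxV x⟩
  have hWinj : ∀ x, (W x).InjOn f := fun x => (hVinj x).mono inter_subset_right
  have hWdisj : (f ⁻¹' {y}).PairwiseDisjoint W :=
    hdisj.mono fun x => (inter_subset_left : U x ∩ V x ⊆ U x)
  -- the closed complement of the union of the `W x` and its closed image
  set C : Set X := (⋃ x ∈ f ⁻¹' {y}, W x)ᶜ with hC
  have hCc : IsClosed C := (isOpen_biUnion fun x _ => hWo x).isClosed_compl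
  have hfC : IsClosed (f '' C) := hp.isClosedMap _ hCc
  have hyC : y ∉ f '' C := by
    rintro ⟨c, hc, hcy⟩
    exact hc (mem_iUnion₂.2 ⟨c, hcy, hxW c⟩)
  -- the neighbourhood of `y` on which the count is constant
  set N : Set Y := (⋂ x ∈ f ⁻¹' {y}, f '' W x) ∩ (f '' C)ᶜ with hN
  have hNo : IsOpen N :=
    (hfin.isOpen_biInter fun x _ => hf.isOpenMap _ (hWo x)).inter hfC.isOpen_compl
  have hyN : y ∈ N := ⟨mem_iInter₂.2 fun x hx => ⟨x, hxW x, hx⟩, hyC⟩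
  filter_upwards [hNo.mem_nhds hyN] with y' hy'
  -- every point over `y'` lies in some `W x`
  have hsub : f ⁻¹' {y'} ⊆ ⋃ x ∈ f ⁻¹' {y}, W x := by
    intro x' hx'
    by_contra h
    exact hy'.2 ⟨x', h, hx'⟩
  -- over `y'`, each `W x` contains a point `g x`
  have hex : ∀ x ∈ f ⁻¹' {y}, ∃ x' ∈ W x, f x' = y' := fun x hx => by
    obtain ⟨x', hx'W, hx'y⟩ := mem_iInter₂.1 hy'.1 x hx
    exact ⟨x', hx'W, hx'y⟩
  choose! g hgW hgy using hex
  -- the fibre of `y'` is the injective image of the fibre of `y` under `g`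
  have himage : f ⁻¹' {y'} = g '' (f ⁻¹' {y}) := by
    apply Subset.antisymm
    · intro x' hx'
      obtain ⟨x, hx, hx'W⟩ := mem_iUnion₂.1 (hsub hx')
      have hfx' : f x' = y' := hx'
      refine ⟨x, hx, hWinj x (hgW x hx) hx'W ?_⟩
      rw [hgy x hx, hfx']
    · rintro _ ⟨x, hx, rfl⟩
      exact hgy x hx
  have hginj : (f ⁻¹' {y}).InjOn g := by
    intro x₁ hx₁ x₂ hx₂ heq
    by_contra hne
    have hd : Disjoint (W x₁) (W x₂) := hWdisj hx₁ hx₂ hne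
    exact Set.disjoint_left.1 hd (hgW x₁ hx₁) (heq ▸ hgW x₂ hx₂)
  rw [himage, hginj.ncard_image]

/-- The fibre cardinality of a proper local homeomorphism (Hausdorff source) is constant along
every preconnected subset of the target. [folklore] -/
theorem IsLocalHomeomorph.ncard_preimage_eq_of_isPreconnected [T2Space X]
    (hf : IsLocalHomeomorph f) (hp : IsProperMap f) {s : Set Y} (hs : IsPreconnected s)
    {y y' : Y} (hy : y ∈ s) (hy' : y' ∈ s) : (f ⁻¹' {y}).ncard = (f ⁻¹' {y'}).ncard :=
  (IsLocalHomeomorph.isLocallyConstant_ncard_preimage hf hp).apply_eq_of_isPreconnected hs hy hy'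

/-- The fibre cardinality of a proper local homeomorphism (Hausdorff source, preconnected target)
is constant. [folklore] -/
theorem IsLocalHomeomorph.ncard_preimage_eq [T2Space X] [PreconnectedSpace Y]
    (hf : IsLocalHomeomorph f) (hp : IsProperMap f) (y y' : Y) :
    (f ⁻¹' {y}).ncard = (f ⁻¹' {y'}).ncard :=
  (IsLocalHomeomorph.isLocallyConstant_ncard_preimage hf hp).apply_eq_of_preconnectedSpace y y'

/-! ### Surjectivity and bijectivity -/

/-- A proper local homeomorphism from a nonempty space to a preconnected space is onto: its range
is open (`f` open) and closed (`f` proper). [folklore] -/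
theorem IsLocalHomeomorph.surjective_of_isProperMap [PreconnectedSpace Y] [Nonempty X]
    (hf : IsLocalHomeomorph f) (hp : IsProperMap f) : Surjective f := by
  have hclopen : IsClopen (range f) := ⟨hp.isClosed_range, hf.isOpenMap.isOpen_range⟩
  rw [← range_eq_univ]
  exact hclopen.eq_univ (range_nonempty f)

/-- **One good fibre makes a proper local homeomorphism bijective.** Let `f : X → Y` be a proper
local homeomorphism, `X` Hausdorff, and suppose that every point of `Y` lies in the connected
component of a point `y'` over which there is exactly one point of `X`.  Then `f` is a
bijection: the fibre cardinality is constant on components, equal to `1`. Forster (1981), §4.24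
(unbranched proper coverings of degree one). [folklore] -/
theorem IsLocalHomeomorph.bijective_of_forall_existsUnique [T2Space X]
    (hf : IsLocalHomeomorph f) (hp : IsProperMap f)
    (h : ∀ y, ∃ y' ∈ connectedComponent y, ∃! x, f x = y') : Bijective f := by
  -- every fibre is a singleton
  have hall : ∀ y, ∃ x, f ⁻¹' {y} = {x} := fun y => by
    obtain ⟨y', hy', x₀, hx₀, huniq⟩ := h y
    have h1 : (f ⁻¹' {y'}).ncard = 1 := by
      rw [Set.ncard_eq_one]
      refine ⟨x₀, Subset.antisymm (fun x hx => huniq x hx) ?_⟩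
      rintro _ rfl
      exact hx₀
    exact Set.ncard_eq_one.1 ((IsLocalHomeomorph.ncard_preimage_eq_of_isPreconnected hf hp
      isPreconnected_connectedComponent mem_connectedComponent hy').trans h1)
  refine ⟨fun x₁ x₂ heq => ?_, fun y => ?_⟩
  · obtain ⟨x, hx⟩ := hall (f x₂)
    have h₁ : x₁ ∈ f ⁻¹' {f x₂} := heq
    have h₂ : x₂ ∈ f ⁻¹' {f x₂} := rfl
    rw [hx] at h₁ h₂
    exact (mem_singleton_iff.1 h₁).trans (mem_singleton_iff.1 h₂).symm
  · obtain ⟨x, hx⟩ := hall y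
    have hxm : x ∈ f ⁻¹' {y} := by rw [hx]; exact mem_singleton x
    exact ⟨x, hxm⟩

/-- **One good fibre makes a proper local homeomorphism onto a connected space bijective**: if
`f : X → Y` is a proper local homeomorphism, `X` Hausdorff, `Y` connected, and some point of `Y`
has exactly one preimage, then `f` is a bijection. [folklore] -/
theorem IsLocalHomeomorph.bijective_of_existsUnique [T2Space X] [PreconnectedSpace Y]
    (hf : IsLocalHomeomorph f) (hp : IsProperMap f) (h : ∃ y, ∃! x, f x = y) : Bijective f := by
  obtain ⟨y₀, hy₀⟩ := h
  refine IsLocalHomeomorph.bijective_of_forall_existsUnique hf hp fun y => ⟨y₀, ?_, hy₀⟩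
  rw [PreconnectedSpace.connectedComponent_eq_univ y]
  exact mem_univ _

/-- A bijective local homeomorphism is a homeomorphism (it is continuous and open; Mathlib's
`Equiv.toHomeomorphOfContinuousOpen`). [folklore] -/
theorem IsLocalHomeomorph.exists_homeomorph_of_bijective (hf : IsLocalHomeomorph f)
    (hb : Bijective f) : ∃ e : X ≃ₜ Y, ⇑e = f :=
  ⟨(Equiv.ofBijective f hb).toHomeomorphOfContinuousOpen hf.continuous hf.isOpenMap, rfl⟩

/-- A proper local homeomorphism with Hausdorff source and one singleton fibre in each component
of the target is a homeomorphism. [folklore] -/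
theorem IsLocalHomeomorph.exists_homeomorph_of_forall_existsUnique [T2Space X]
    (hf : IsLocalHomeomorph f) (hp : IsProperMap f)
    (h : ∀ y, ∃ y' ∈ connectedComponent y, ∃! x, f x = y') : ∃ e : X ≃ₜ Y, ⇑e = f :=
  IsLocalHomeomorph.exists_homeomorph_of_bijective hf
    (IsLocalHomeomorph.bijective_of_forall_existsUnique hf hp h)

/-! ### Self-maps which are the identity off a compact set -/

/-- A continuous self-map of a Hausdorff, weakly locally compact space which is the identity off
a compact set `K` is proper: the preimage of a compact `L` is a closed subset of `K ∪ L`.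
[folklore] -/
theorem isProperMap_of_forall_notMem [T2Space X] [WeaklyLocallyCompactSpace X] {f : X → X}
    (hf : Continuous f) {K : Set X} (hK : IsCompact K) (heq : ∀ x ∉ K, f x = x) :
    IsProperMap f := by
  rw [isProperMap_iff_isCompact_preimage]
  refine ⟨hf, fun L hL => ?_⟩
  refine (hK.union hL).of_isClosed_subset (hL.isClosed.preimage hf) fun x hx => ?_
  by_cases hxK : x ∈ K
  · exact Or.inl hxK
  · right
    have hfx : f x ∈ L := hx
    rwa [heq x hxK] at hfx

/-- **A local homeomorphism which is the identity off a compact set is a bijection.** Let `X` be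
Hausdorff, weakly locally compact and connected, `f : X → X` a local homeomorphism with `f x = x`
for `x ∉ K`, `K` compact, and suppose some point `y` lies outside `K ∪ f '' K`.  Then `f` is a
bijection (and a homeomorphism, `IsLocalHomeomorph.exists_homeomorph_of_bijective`): `f` is proper
(`isProperMap_of_forall_notMem`) and the fibre of `y` is `{y}`.  This is the form in which the
sheet count replaces degree theory in Campbell–D'Onofrio–Vítek (2026), Lemma 2.4. [folklore] -/
theorem IsLocalHomeomorph.bijective_of_forall_notMem [T2Space X] [WeaklyLocallyCompactSpace X]
    [PreconnectedSpace X] {f : X → X} (hf : IsLocalHomeomorph f) {K : Set X} (hK : IsCompact K)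
    (heq : ∀ x ∉ K, f x = x) (hy : ∃ y, y ∉ K ∧ y ∉ f '' K) : Bijective f := by
  refine IsLocalHomeomorph.bijective_of_existsUnique hf
    (isProperMap_of_forall_notMem hf.continuous hK heq) ?_
  obtain ⟨y, hyK, hyfK⟩ := hy
  refine ⟨y, y, heq y hyK, fun x hx => ?_⟩
  have hxK : x ∉ K := fun hxK => hyfK ⟨x, hxK, hx⟩
  exact (heq x hxK).symm.trans hx

end Literature.Topology
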